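import Summits.ABC.ABC.Theorems.RibetTakahashiSplitAbcValuationProductOfCurves
import Summits.ABC.ABC.Theorems.AbcValuationProduct
import Literature.NumberTheory.DiophantineGeometry.AbcWave0MihailescuProofs
import Literature.NumberTheory.DiophantineGeometry.AbcWave0QualityFormProofs

/-!
# `AbcValuationProduct`: the two-prime regime is a theorem (Mihăilescu)

The route item `Summit.ABC.ABC.Theses.RibetTakahashiSplit.AbcValuationProduct`
(`∀ ε > 0 ∃ K, ∀ abc triples, ∏_{p ∣ abc} ν_p(abc) ≤ K · rad(abc)^ε`, Pasten's product-of-valuations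
theorem with `8/3 + ε` replaced by `ε`) is an open milestone; modulo the many-prime crux
`ManyPrimeValuationProduct` it is equivalent to its restriction to triples with at most `3` odd prime
factors (`abcValuationProduct_iff_fewPrimes_of_manyPrimeValuationProduct`).

This file proves the only fragment of the milestone that is unconditionally in reach and removes it
from that residual:

* `AbcValuationProduct.two_pow_exponentProduct_le` — for an abc triple with `ω(abc) ≤ 2` one has
  `2^{∏ ν_p(abc)} ≤ 64 · rad(abc)`. Such a triple is `1 + 1 = 2`, `1 + 2^k = p^m` or `1 + p^m = 2^k`;
  by **Mihăilescu's theorem** (Catalan's conjecture, in the tree as `mihailescu_holds`) either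
  `min(k, m) = 1` — and then `∏ ν_p = max(k, m)` with `2^{max} ≤ c ≤ rad` — or the triple is
  `1 + 8 = 9` (`∏ ν_p = 6`, `rad = 6`).
* `AbcValuationProduct.of_card_primeFactors_le_two` — hence `∏ ν_p(abc) ≤ K_ε rad(abc)^ε` on these
  triples (`log x ≤ x^ε/ε`): the milestone HOLDS in the regime `ω(abc) ≤ 2`.
* `AbcValuationProduct.two_mem_primeFactors` / `card_primeFactors_erase_two` — `2 ∣ abc` for every
  abc triple, so "`≤ 3` odd prime factors" is "`ω(abc) ≤ 4`".
* `AbcValuationProduct.fewPrimes_of_fewPrimeValuationProduct` /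
  `AbcValuationProduct.fiveLe_of_manyPrimeValuationProduct` — in triple language the few-prime crux
  r4 ALONE gives the milestone on `ω(abc) ≤ 4` and the many-prime crux r2 alone gives it on
  `ω(abc) ≥ 5` (Frey curve: `N ∣ 2⁸ rad`, `∏ ν_p ≤ 4 T(E)`).
* `abcValuationProduct_iff_fiveLe_and_threeFour` — unconditionally, the milestone is the
  conjunction of its restrictions to `ω(abc) ≥ 5` and to `ω(abc) ∈ {3, 4}`.
* `abcValuationProduct_iff_threeFour_of_manyPrimeValuationProduct` — modulo r2 the milestone is
  therefore EQUIVALENT to its restriction to triples with `ω(abc) ∈ {3, 4}`: the bound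
  `∏ (exponents) ≪_ε rad^ε`, uniform in the primes, for the coprime `S`-unit equations `a + b = c`
  with `S = {2, p, q}` or `{2, p, q, r}` (Pillai type: `p^x ± q^y = 2^z`, `p^x q^y ± 1 = 2^z`,
  `2^z p^x ± q^y = r^w`, …). This — not the full few-prime crux `FewPrimeValuationProduct` — is the
  exact few-prime input the milestone consumes.
-/

-- `Summit.<Summit>.<Problem>` is the mandated summit-side namespace (CONVENTIONS §2); for the
-- single-conjunct summit `ABC` the two coincide, so the duplicate `ABC.ABC` is deliberate.
set_option linter.dupNamespace false

namespace Summit.ABC.ABC.Theorems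

open Literature.NumberTheory.DiophantineGeometry
open Summit.ABC.ABC.Theses.RibetTakahashiSplit

/-! ### Arithmetic of `∏ ν_p` and `rad` on products of two prime powers -/

/-- `∏_{ℓ ∣ q^s r^t} ν_ℓ(q^s r^t) = s · t` for distinct primes `q, r` and `s, t ≥ 1`. `[folklore]` -/
theorem AbcValuationProduct.exponentProduct_primePow_mul_primePow {q r s t : ℕ} (hq : q.Prime)
    (hr : r.Prime) (hqr : q ≠ r) (hs : s ≠ 0) (ht : t ≠ 0) :
    exponentProduct (q ^ s * r ^ t) = s * t := by
  have hq0 : q ^ s ≠ 0 := pow_ne_zero _ hq.ne_zero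
  have hr0 : r ^ t ≠ 0 := pow_ne_zero _ hr.ne_zero
  rw [exponentProduct_def, Nat.primeFactors_mul hq0 hr0, Nat.primeFactors_prime_pow hs hq,
    Nat.primeFactors_prime_pow ht hr, Nat.factorization_mul hq0 hr0, hq.factorization_pow,
    hr.factorization_pow]
  rw [show ({q} ∪ {r} : Finset ℕ) = {q, r} by rfl, Finset.prod_pair hqr]
  simp [hqr, hqr.symm]

/-- `rad` of a triple `(1, q^s, r^t)` with distinct primes `q, r` and `s, t ≥ 1` is `q · r`.
`[folklore]` -/
theorem AbcValuationProduct.rad_one_primePow_primePow {q r s t : ℕ} (hq : q.Prime) (hr : r.Prime)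
    (hqr : q ≠ r) (hs : s ≠ 0) (ht : t ≠ 0) :
    rad 1 (q ^ s) (r ^ t) = q * r := by
  have hq0 : q ^ s ≠ 0 := pow_ne_zero _ hq.ne_zero
  have hr0 : r ^ t ≠ 0 := pow_ne_zero _ hr.ne_zero
  rw [rad_def, one_mul, Nat.radical_eq_prod_primeFactors, Nat.primeFactors_mul hq0 hr0,
    Nat.primeFactors_prime_pow hs hq, Nat.primeFactors_prime_pow ht hr]
  rw [show ({q} ∪ {r} : Finset ℕ) = {q, r} by rfl, Finset.prod_pair hqr]

/-! ### The shape of a triple with at most two prime factors -/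

/-- In an abc triple `a + b = c` with `2 ≤ a` and `2 ≤ b` the product `abc` has at least three prime
factors (the least prime factors of the pairwise coprime `a, b, c ≥ 2` are distinct). `[folklore]` -/
theorem AbcValuationProduct.three_le_card_primeFactors {a b c : ℕ} (h : IsABCTriple a b c)
    (ha : 2 ≤ a) (hb : 2 ≤ b) : 3 ≤ (a * b * c).primeFactors.card := by
  obtain ⟨-, -, habc, hcop⟩ := h
  have h0 : a * b * c ≠ 0 := by subst habc; positivity
  have hac : Nat.Coprime a c := by rw [← habc]; exact Nat.coprime_self_add_right.2 hcop
  have hbc : Nat.Coprime b c := by rw [← habc]; exact Nat.coprime_add_self_right.2 hcop.symm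
  have hpa : a.minFac.Prime := Nat.minFac_prime (by omega)
  have hpb : b.minFac.Prime := Nat.minFac_prime (by omega)
  have hpc : c.minFac.Prime := Nat.minFac_prime (by omega)
  -- the three least prime factors are pairwise distinct
  have hab' : a.minFac ≠ b.minFac := fun he => hpa.one_lt.ne'
    (Nat.Coprime.eq_one_of_dvd (Nat.Coprime.coprime_dvd_left (Nat.minFac_dvd a) hcop)
      (he ▸ Nat.minFac_dvd b))
  have hac' : a.minFac ≠ c.minFac := fun he => hpa.one_lt.ne'
    (Nat.Coprime.eq_one_of_dvd (Nat.Coprime.coprime_dvd_left (Nat.minFac_dvd a) hac)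
      (he ▸ Nat.minFac_dvd c))
  have hbc' : b.minFac ≠ c.minFac := fun he => hpb.one_lt.ne'
    (Nat.Coprime.eq_one_of_dvd (Nat.Coprime.coprime_dvd_left (Nat.minFac_dvd b) hbc)
      (he ▸ Nat.minFac_dvd c))
  have hsub : ({a.minFac, b.minFac, c.minFac} : Finset ℕ) ⊆ (a * b * c).primeFactors := by
    intro p hp
    simp only [Finset.mem_insert, Finset.mem_singleton] at hp
    rw [Nat.mem_primeFactors]
    rcases hp with rfl | rfl | rfl
    · exact ⟨hpa, (Nat.minFac_dvd a).trans (dvd_mul_of_dvd_left (dvd_mul_right a b) c), h0⟩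
    · exact ⟨hpb, (Nat.minFac_dvd b).trans (dvd_mul_of_dvd_left (dvd_mul_left b a) c), h0⟩
    · exact ⟨hpc, (Nat.minFac_dvd c).trans (dvd_mul_left c (a * b)), h0⟩
  have hcard : ({a.minFac, b.minFac, c.minFac} : Finset ℕ).card = 3 :=
    Finset.card_eq_three.2 ⟨_, _, _, hab', hac', hbc', rfl⟩
  exact hcard ▸ Finset.card_le_card hsub

/-- A triple `1 + b = c` with `b ≥ 2` whose product has at most two prime factors is
`1 + q^s = r^t` with `q ≠ r` primes and `s, t ≥ 1`. `[folklore]` -/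
theorem AbcValuationProduct.exists_primePow_of_card_le_two {b c : ℕ} (h : IsABCTriple 1 b c)
    (hb : 2 ≤ b) (h2 : (1 * b * c).primeFactors.card ≤ 2) :
    ∃ q r s t : ℕ, q.Prime ∧ r.Prime ∧ q ≠ r ∧ 0 < s ∧ 0 < t ∧ b = q ^ s ∧ c = r ^ t := by
  obtain ⟨-, -, hbc, -⟩ := h
  have hcop : Nat.Coprime b c := by rw [← hbc]; exact Nat.coprime_add_self_right.2 (Nat.coprime_one_right b)
  have hb0 : b ≠ 0 := by omega
  have hc0 : c ≠ 0 := by omega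
  rw [one_mul, Nat.primeFactors_mul hb0 hc0,
    Finset.card_union_of_disjoint hcop.disjoint_primeFactors] at h2
  have hb1 : 1 ≤ b.primeFactors.card := Finset.card_pos.2 (Nat.nonempty_primeFactors.2 (by omega))
  have hc1 : 1 ≤ c.primeFactors.card := Finset.card_pos.2 (Nat.nonempty_primeFactors.2 (by omega))
  obtain ⟨q, s, hq, hs, rfl⟩ :=
    (isPrimePow_nat_iff b).1 (isPrimePow_iff_card_primeFactors_eq_one.2 (by omega))
  obtain ⟨r, t, hr, ht, rfl⟩ :=
    (isPrimePow_nat_iff c).1 (isPrimePow_iff_card_primeFactors_eq_one.2 (by omega))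
  refine ⟨q, r, s, t, hq, hr, fun hqr => ?_, hs, ht, rfl, rfl⟩
  subst hqr
  exact hq.one_lt.ne' (Nat.Coprime.eq_one_of_dvd
    (Nat.Coprime.coprime_dvd_left (dvd_pow_self q hs.ne') hcop) (dvd_pow_self q ht.ne'))

/-! ### The two-prime case of the milestone -/

/-- **Two-prime regime, via Mihăilescu.** For an abc triple whose product has at most two prime
factors, `2^{∏_{p ∣ abc} ν_p(abc)} ≤ 64 · rad(abc)`. Up to symmetry the triple is `1 + 1 = 2`, or
`1 + q^s = r^t` with `{q, r} ∋ 2`; by Mihăilescu's theorem (`mihailescu_holds`: the only solution of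
`x^a - y^b = 1` with `a, b ≥ 2` is `3² - 2³`) either `s = 1` or `t = 1` — then `∏ ν_p = max(s,t)`
and `2^{max(s,t)} ≤ c ≤ q r = rad` — or `(q, s, r, t) = (2, 3, 3, 2)`, where `∏ ν_p = 6` and
`rad = 6`. [cite: Mihailescu2004, Theorem 1] -/
theorem AbcValuationProduct.two_pow_exponentProduct_le {a b c : ℕ} (h : IsABCTriple a b c)
    (h2 : (a * b * c).primeFactors.card ≤ 2) :
    2 ^ exponentProduct (a * b * c) ≤ 64 * rad a b c := by
  have hrad : ∀ a b c : ℕ, 1 ≤ rad a b c := fun a b c => by rw [rad_def]; exact Nat.radical_pos _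
  obtain ⟨ha, hb, habc, hcop⟩ := h
  wlog hab : a ≤ b generalizing a b
  · have := this (by rwa [mul_comm b a]) hb ha (by omega) hcop.symm (by omega)
    simpa only [rad_def, mul_comm b a] using this
  rcases hab.eq_or_lt with rfl | hlt
  · -- `a = b` forces `a = b = 1`, `c = 2`
    have ha1 : a = 1 := (Nat.coprime_self a).1 hcop
    subst ha1
    have hc : c = 2 := by omega
    subst hc
    have hE : exponentProduct (1 * 1 * 2) ≤ 2 := by
      calc exponentProduct (1 * 1 * 2) ≤ (1 * 1 * 2).divisors.card :=
            exponentProduct_le_card_divisors (by norm_num)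
        _ = 2 := by decide
    calc 2 ^ exponentProduct (1 * 1 * 2) ≤ 2 ^ 2 := Nat.pow_le_pow_right (by norm_num) hE
      _ ≤ 64 * 1 := by norm_num
      _ ≤ 64 * rad 1 1 2 := Nat.mul_le_mul_left _ (hrad 1 1 2)
  rcases le_or_gt 2 a with ha2 | ha2
  · -- `2 ≤ a < b`: three pairwise coprime members `≥ 2`, contradiction
    have := AbcValuationProduct.three_le_card_primeFactors ⟨ha, hb, habc, hcop⟩ ha2 (by omega)
    omega
  · -- `a = 1`, `1 + q^s = r^t`
    obtain rfl : a = 1 := by omega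
    obtain ⟨q, r, s, t, hq, hr, hqr, hs, ht, rfl, rfl⟩ :=
      AbcValuationProduct.exists_primePow_of_card_le_two ⟨ha, hb, habc, hcop⟩ (by omega) h2
    rw [one_mul, AbcValuationProduct.exponentProduct_primePow_mul_primePow hq hr hqr hs.ne' ht.ne',
      AbcValuationProduct.rad_one_primePow_primePow hq hr hqr hs.ne' ht.ne']
    have hq2 := hq.two_le
    have hr2 := hr.two_le
    have hqr1 : q * 2 ≤ q * r := Nat.mul_le_mul_left q hr2
    by_cases hst : 2 ≤ s ∧ 2 ≤ t
    · -- Catalan: `r^t = q^s + 1` with `s, t ≥ 2` ⇒ `3² = 2³ + 1`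
      obtain ⟨rfl, rfl, rfl, rfl⟩ :=
        mihailescu_holds hq.pos hst.2 hst.1 (show r ^ t = q ^ s + 1 by omega)
      norm_num
    · rcases not_and_or.1 hst with hs1 | ht1
      · -- `s = 1`: `∏ ν = t`, `2^t ≤ r^t = q + 1 ≤ q r`
        obtain rfl : s = 1 := by omega
        rw [one_mul]
        calc 2 ^ t ≤ r ^ t := Nat.pow_le_pow_left hr2 t
          _ = q ^ 1 + 1 := by omega
          _ ≤ q * r := by rw [pow_one]; nlinarith
          _ ≤ 64 * (q * r) := Nat.le_mul_of_pos_left _ (by norm_num)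
      · -- `t = 1`: `∏ ν = s`, `2^s ≤ q^s < r ≤ q r`
        obtain rfl : t = 1 := by omega
        rw [mul_one]
        calc 2 ^ s ≤ q ^ s := Nat.pow_le_pow_left hq2 s
          _ ≤ r ^ 1 := by omega
          _ ≤ q * r := by rw [pow_one]; nlinarith
          _ ≤ 64 * (q * r) := Nat.le_mul_of_pos_left _ (by norm_num)

/-- **The milestone holds in the two-prime regime.** For every `ε > 0` there is `K` with
`∏_{p ∣ abc} ν_p(abc) ≤ K · rad(abc)^ε` for all abc triples whose product has at most two prime
factors (from `2^{∏ ν_p} ≤ 64 rad` and `log x ≤ x^ε/ε`; `K = (log 64 + 1/ε)/log 2`).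
[cite: Mihailescu2004, Theorem 1] -/
theorem AbcValuationProduct.of_card_primeFactors_le_two :
    ∀ ε : ℝ, 0 < ε → ∃ K : ℝ, ∀ a b c : ℕ, IsABCTriple a b c → (a * b * c).primeFactors.card ≤ 2 →
      (exponentProduct (a * b * c) : ℝ) ≤ K * (rad a b c : ℝ) ^ ε := by
  intro ε hε
  refine ⟨(Real.log 64 + 1 / ε) / Real.log 2, fun a b c ht h2 => ?_⟩
  have hR : (0 : ℝ) < (rad a b c : ℝ) := cast_rad_pos a b c
  set R : ℝ := (rad a b c : ℝ) with hRdef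
  set E : ℕ := exponentProduct (a * b * c) with hEdef
  have hR1 : (1 : ℝ) ≤ R := by
    rw [hRdef]; exact_mod_cast (le_trans (by norm_num) ht.two_le_rad : 1 ≤ rad a b c)
  have h1 : (2 : ℝ) ^ E ≤ 64 * R := by
    rw [hRdef, hEdef]; exact_mod_cast AbcValuationProduct.two_pow_exponentProduct_le ht h2
  have hlog2 : 0 < Real.log 2 := Real.log_pos (by norm_num)
  have h2' : (E : ℝ) * Real.log 2 ≤ Real.log 64 + Real.log R := by
    rw [← Real.log_pow, ← Real.log_mul (by norm_num) hR.ne']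
    exact Real.log_le_log (by positivity) h1
  have h3 : Real.log R ≤ R ^ ε / ε := Real.log_le_rpow_div hR.le hε
  have hRε : 1 ≤ R ^ ε := Real.one_le_rpow hR1 hε.le
  have h4 : Real.log 64 ≤ Real.log 64 * R ^ ε :=
    le_mul_of_one_le_right (Real.log_nonneg (by norm_num)) hRε
  calc (E : ℝ) = (E * Real.log 2) / Real.log 2 := by field_simp
    _ ≤ (Real.log 64 + Real.log R) / Real.log 2 := div_le_div_of_nonneg_right h2' hlog2.le
    _ ≤ (Real.log 64 * R ^ ε + R ^ ε / ε) / Real.log 2 :=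
        div_le_div_of_nonneg_right (add_le_add h4 h3) hlog2.le
    _ = (Real.log 64 + 1 / ε) / Real.log 2 * R ^ ε := by
        field_simp

/-! ### `2 ∣ abc`: counting odd prime factors -/

/-- The product of an abc triple is even (`a, b` odd forces `c = a + b` even). `[folklore]` -/
theorem AbcValuationProduct.two_mem_primeFactors {a b c : ℕ} (h : IsABCTriple a b c) :
    2 ∈ (a * b * c).primeFactors := by
  have h0 := h.mul_ne_zero
  obtain ⟨-, -, habc, -⟩ := h
  refine Nat.mem_primeFactors.2 ⟨Nat.prime_two, ?_, h0⟩
  rw [← even_iff_two_dvd, Nat.even_mul, Nat.even_mul]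
  rcases Nat.even_or_odd a with ha | ha
  · exact Or.inl (Or.inl ha)
  rcases Nat.even_or_odd b with hb | hb
  · exact Or.inl (Or.inr hb)
  · exact Or.inr (habc ▸ ha.add_odd hb)

/-- For an abc triple, the number of odd prime factors of `abc` is `ω(abc) - 1`. `[folklore]` -/
theorem AbcValuationProduct.card_primeFactors_erase_two {a b c : ℕ} (h : IsABCTriple a b c) :
    ((a * b * c).primeFactors.erase 2).card = (a * b * c).primeFactors.card - 1 :=
  Finset.card_erase_of_mem (AbcValuationProduct.two_mem_primeFactors h)

/-! ### What each crux gives, in triple language -/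

/-- **Few-prime half of the milestone, from r4 alone.** `FewPrimeValuationProduct` implies the
product-of-valuations bound with exponent `ε` for every abc triple with `ω(abc) ≤ 4` (at most `3`
odd prime factors): the Frey curve `E` of `AbcValuationProduct.exists_freyCurve` has
`N_E ∣ 2⁸ rad(abc)`, hence at most `3` odd multiplicative primes, r4 gives `T(E) ≤ C N_E^ε`, and
`∏ v_p(abc) ≤ 4 T(E) ≤ 4 C (2⁸ rad)^ε`; the many-prime crux is not used (companion of
`AbcValuationProduct.manyPrimes_of_manyPrimeValuationProduct`). `[folklore]` -/
theorem AbcValuationProduct.fewPrimes_of_fewPrimeValuationProduct (h₄ : FewPrimeValuationProduct) :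
    ∀ ε : ℝ, 0 < ε → ∃ K : ℝ, ∀ a b c : ℕ, IsABCTriple a b c →
      (a * b * c).primeFactors.card ≤ 4 →
      (exponentProduct (a * b * c) : ℝ) ≤ K * (rad a b c : ℝ) ^ ε := by
  intro ε hε
  obtain ⟨C₄, hC₄⟩ := h₄ ε hε
  refine ⟨4 * max C₄ 0 * ((2 : ℝ) ^ 8) ^ ε, fun a b c ht h4 => ?_⟩
  obtain ⟨W, hE, hss, hN, -, hprod⟩ := AbcValuationProduct.exists_freyCurve ht
  haveI := hE
  have hR : (0 : ℝ) < (rad a b c : ℝ) := cast_rad_pos a b c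
  have hrad0 : rad a b c ≠ 0 := by rw [rad_def]; exact (Nat.radical_pos _).ne'
  have h28 : 2 ^ 8 * rad a b c ≠ 0 := mul_ne_zero (by norm_num) hrad0
  -- the odd multiplicative primes of the Frey curve are odd primes of `abc`: at most `3` of them
  have hsub : (W.conductorNorm ℤ).primeFactors.filter
      (fun p => p ≠ 2 ∧ ¬ p ^ 2 ∣ W.conductorNorm ℤ) ⊆ (a * b * c).primeFactors.erase 2 := by
    intro p hp
    rw [Finset.mem_filter] at hp
    refine Finset.mem_erase.2 ⟨hp.2.1, ?_⟩
    have h1 : p ∈ (2 ^ 8 * rad a b c).primeFactors := Nat.primeFactors_mono hN h28 hp.1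
    rw [Nat.primeFactors_mul (by norm_num) hrad0, Nat.primeFactors_prime_pow (by norm_num)
      Nat.prime_two, rad_def, Nat.primeFactors_radical, Finset.mem_union,
      Finset.mem_singleton] at h1
    exact h1.resolve_left hp.2.1
  have h3 : ((W.conductorNorm ℤ).primeFactors.filter
      (fun p => p ≠ 2 ∧ ¬ p ^ 2 ∣ W.conductorNorm ℤ)).card ≤ 3 := by
    have := Finset.card_le_card hsub
    rw [AbcValuationProduct.card_primeFactors_erase_two ht] at this
    omega
  have hT : (multiplicativeValuationProduct W : ℝ) ≤ max C₄ 0 * (W.conductorNorm ℤ : ℝ) ^ ε :=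
    (hC₄ W hss h3).trans (mul_le_mul_of_nonneg_right (le_max_left _ _) (by positivity))
  -- `N ≤ 2⁸ rad`
  have hNR : (W.conductorNorm ℤ : ℝ) ≤ 2 ^ 8 * (rad a b c : ℝ) := by
    exact_mod_cast Nat.le_of_dvd (Nat.pos_of_ne_zero h28) hN
  have hC0 : (0 : ℝ) ≤ max C₄ 0 := le_max_right _ _
  calc (exponentProduct (a * b * c) : ℝ) ≤ ((4 * multiplicativeValuationProduct W : ℕ) : ℝ) := by
        exact_mod_cast hprod
    _ = 4 * (multiplicativeValuationProduct W : ℝ) := by push_cast; ring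
    _ ≤ 4 * (max C₄ 0 * (W.conductorNorm ℤ : ℝ) ^ ε) := by linarith
    _ ≤ 4 * (max C₄ 0 * ((2 : ℝ) ^ 8 * (rad a b c : ℝ)) ^ ε) := by gcongr
    _ = 4 * max C₄ 0 * ((2 : ℝ) ^ 8) ^ ε * (rad a b c : ℝ) ^ ε := by
        rw [Real.mul_rpow (by positivity) hR.le]; ring

/-- **Many-prime half of the milestone, from r2 alone, in `ω` form.** `ManyPrimeValuationProduct`
implies the bound with exponent `ε` for every abc triple with `ω(abc) ≥ 5`
(`AbcValuationProduct.manyPrimes_of_manyPrimeValuationProduct` with `2 ∣ abc`). `[folklore]` -/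
theorem AbcValuationProduct.fiveLe_of_manyPrimeValuationProduct (h₂ : ManyPrimeValuationProduct) :
    ∀ ε : ℝ, 0 < ε → ∃ K : ℝ, ∀ a b c : ℕ, IsABCTriple a b c →
      5 ≤ (a * b * c).primeFactors.card →
      (exponentProduct (a * b * c) : ℝ) ≤ K * (rad a b c : ℝ) ^ ε := by
  intro ε hε
  obtain ⟨K, hK⟩ := AbcValuationProduct.manyPrimes_of_manyPrimeValuationProduct h₂ ε hε
  refine ⟨K, fun a b c ht h5 => hK a b c ht ?_⟩
  rw [AbcValuationProduct.card_primeFactors_erase_two ht]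
  omega

/-- **The milestone, decomposed by `ω(abc)` (unconditional).** `AbcValuationProduct` is
equivalent to the conjunction of its restrictions to triples with `ω(abc) ≥ 5` and with
`ω(abc) ∈ {3, 4}`; the remaining regime `ω(abc) ≤ 2` is the theorem
`AbcValuationProduct.of_card_primeFactors_le_two`. The first conjunct follows from r2
(`AbcValuationProduct.fiveLe_of_manyPrimeValuationProduct`), the second from r4
(`AbcValuationProduct.fewPrimes_of_fewPrimeValuationProduct`); both are open. `[folklore]` -/
theorem abcValuationProduct_iff_fiveLe_and_threeFour :
    AbcValuationProduct ↔
      (∀ ε : ℝ, 0 < ε → ∃ K : ℝ, ∀ a b c : ℕ, IsABCTriple a b c →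
        5 ≤ (a * b * c).primeFactors.card →
        (exponentProduct (a * b * c) : ℝ) ≤ K * (rad a b c : ℝ) ^ ε) ∧
      (∀ ε : ℝ, 0 < ε → ∃ K : ℝ, ∀ a b c : ℕ, IsABCTriple a b c →
        3 ≤ (a * b * c).primeFactors.card → (a * b * c).primeFactors.card ≤ 4 →
        (exponentProduct (a * b * c) : ℝ) ≤ K * (rad a b c : ℝ) ^ ε) := by
  refine ⟨fun h => ⟨fun ε hε => ?_, fun ε hε => ?_⟩, fun ⟨h5, h34⟩ ε hε => ?_⟩
  · obtain ⟨K, hK⟩ := h ε hε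
    exact ⟨K, fun a b c ht _ => hK a b c ht⟩
  · obtain ⟨K, hK⟩ := h ε hε
    exact ⟨K, fun a b c ht _ _ => hK a b c ht⟩
  · obtain ⟨K₂, hK₂⟩ := AbcValuationProduct.of_card_primeFactors_le_two ε hε
    obtain ⟨K₃, hK₃⟩ := h34 ε hε
    obtain ⟨K₅, hK₅⟩ := h5 ε hε
    refine ⟨max (max K₂ K₃) K₅, fun a b c ht => ?_⟩
    have hR : (0 : ℝ) < (rad a b c : ℝ) := cast_rad_pos a b c
    have hpow : (0 : ℝ) ≤ (rad a b c : ℝ) ^ ε := by positivity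
    rcases le_or_gt (a * b * c).primeFactors.card 2 with h2 | h3
    · exact (hK₂ a b c ht h2).trans (mul_le_mul_of_nonneg_right
        ((le_max_left _ _).trans (le_max_left _ _)) hpow)
    rcases le_or_gt (a * b * c).primeFactors.card 4 with h4 | h5'
    · exact (hK₃ a b c ht (by omega) h4).trans (mul_le_mul_of_nonneg_right
        ((le_max_right _ _).trans (le_max_left _ _)) hpow)
    · exact (hK₅ a b c ht (by omega)).trans (mul_le_mul_of_nonneg_right (le_max_right _ _) hpow)

/-! ### The residual of the milestone modulo r2: `ω(abc) ∈ {3, 4}` -/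

/-- **Modulo r2, the milestone is its `ω ∈ {3, 4}` shadow.** Given `ManyPrimeValuationProduct`,
`AbcValuationProduct` is equivalent to its restriction to abc triples with `ω(abc) ∈ {3, 4}`
(i.e. exactly `2` or `3` odd prime factors: coprime `S`-unit equations `a + b = c` over
`S = {2, p, q}` or `{2, p, q, r}` — Pillai type `p^x ± q^y = 2^z`, `p^x q^y ± 1 = 2^z`,
`2^z p^x ± q^y = r^w`, … — with the bound `∏ (exponents) ≪_ε rad^ε` uniform in the primes). The
case `ω(abc) ≥ 5` is r2 via the Frey curve
(`AbcValuationProduct.manyPrimes_of_manyPrimeValuationProduct`), the case `ω(abc) ≤ 2` is the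
theorem `AbcValuationProduct.of_card_primeFactors_le_two` (Mihăilescu). `[folklore]` -/
theorem abcValuationProduct_iff_threeFour_of_manyPrimeValuationProduct
    (h₂ : ManyPrimeValuationProduct) :
    AbcValuationProduct ↔ ∀ ε : ℝ, 0 < ε → ∃ K : ℝ, ∀ a b c : ℕ, IsABCTriple a b c →
      3 ≤ (a * b * c).primeFactors.card → (a * b * c).primeFactors.card ≤ 4 →
      (exponentProduct (a * b * c) : ℝ) ≤ K * (rad a b c : ℝ) ^ ε := by
  refine ⟨fun h ε hε => ?_, fun h => ?_⟩
  · obtain ⟨K, hK⟩ := h ε hε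
    exact ⟨K, fun a b c ht _ _ => hK a b c ht⟩
  · refine exponentProductBound_of_manyPrimeValuationProduct_of_fewPrimes h₂ fun ε hε => ?_
    obtain ⟨K₂, hK₂⟩ := AbcValuationProduct.of_card_primeFactors_le_two ε hε
    obtain ⟨K₃, hK₃⟩ := h ε hε
    refine ⟨max K₂ K₃, fun a b c ht h3 => ?_⟩
    have hR : (0 : ℝ) < (rad a b c : ℝ) := cast_rad_pos a b c
    have h4 : (a * b * c).primeFactors.card ≤ 4 := by
      have := AbcValuationProduct.card_primeFactors_erase_two ht
      have hpos : 1 ≤ (a * b * c).primeFactors.card :=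
        Finset.card_pos.2 ⟨2, AbcValuationProduct.two_mem_primeFactors ht⟩
      omega
    rcases le_or_gt 3 (a * b * c).primeFactors.card with h3' | h2'
    · exact (hK₃ a b c ht h3' h4).trans
        (mul_le_mul_of_nonneg_right (le_max_right _ _) (by positivity))
    · exact (hK₂ a b c ht (by omega)).trans
        (mul_le_mul_of_nonneg_right (le_max_left _ _) (by positivity))

end Summit.ABC.ABC.Theorems
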